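import Summits.Langlands.Langlands.Theses.SmallRangeOrdinaryCarving

/-!
# Route SmallRangeOrdinaryCarving — Assembly

The assembly item (stmt-Langlands-27896) of the child route `SmallRangeOrdinaryCarving` (decomp-langlands lens-6 gen 25; second V-R refining child
`--refines route-Langlands-ParahoricFibre:SmallRangeGenericMonodromy`, edge split, depth 1; OR-sibling of `MonodromyRankLadder`) for
T = `ParahoricFibre.SmallRangeGenericMonodromy` (stmt-Langlands-18195):
`OrdinaryBoxGenericMonodromy → OffOrdinaryBoxGenericMonodromy → ParahoricFibre.SmallRangeGenericMonodromy`.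

This is literally the type of the route file's sorry-free deciding theorem `Summit.Langlands.Langlands.Theses.SmallRangeOrdinaryCarving.closes`
(pointwise excluded middle on the Matsumoto-box dial MB(K,n,p,ρ)).
Nothing here proves `Langlands` (nor the parent piece): the assembly records only that the two cells of the route (ORDBOX and the declared residual OFFBOX),
taken together, imply the parent piece by name.
-/

set_option linter.dupNamespace false -- project-wide option (lakefile weak.linter.dupNamespace); `Summit.Langlands.Langlands` is the mandated namespace

namespace Summit.Langlands.Langlands.Theorems

/-- **Assembly of route SmallRangeOrdinaryCarving** (stmt-Langlands-27896):
`OrdinaryBoxGenericMonodromy → OffOrdinaryBoxGenericMonodromy → ParahoricFibre.SmallRangeGenericMonodromy`.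
Proof: unfold `Assembly` and apply the route's deciding theorem `Theses.SmallRangeOrdinaryCarving.closes`. -/
theorem smallRangeOrdinaryCarving_assembly_proof :
    Summit.Langlands.Langlands.Theses.SmallRangeOrdinaryCarving.Assembly := by
  unfold Summit.Langlands.Langlands.Theses.SmallRangeOrdinaryCarving.Assembly
  exact Summit.Langlands.Langlands.Theses.SmallRangeOrdinaryCarving.closes

end Summit.Langlands.Langlands.Theorems
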